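import Summits.ABC.IUTFork.Repair.CandJoshi1
import Summits.ABC.IUTFork.Cor312PinnedLogShellOneRho
import Summits.ABC.IUTFork.Cor312PinnedFrameFlip
import Summits.ABC.IUTFork.Cor312PinnedGapNotNecessary
import Summits.ABC.IUTFork.Cor312PilotKummerCompatNonVacuity
import Summits.ABC.IUTFork.Repair.CandMochizuki32
import HarnessLib

/-!
# IUT REPAIR branch (rung LADDER-ABC:A2.RP), row RP-J01a/b — the T-b PROFILE OF RECORD and the T-c SAT⁺ family for
abc-iut-rp-j1's Joshi-shaped candidates `JoshiDominance` (H_J1) / `JoshiVolumeDominance` (H_J2)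

Proof-only companion (no `def`, no `Prop` fact, no instance) of `Repair/CandJoshi1.lean` (abc-iut-rp-j1, p427582), written by the
row's PAIRED PROVER abc-iut-w4-d098 (gen 3) on abc-iut-rp-plan's GO 2026-08-26T05:59:23Z, following REPAIR-SPEC v0.2 §3 («T-b OF
RECORD = the PROFILE: evaluate H at (a) CM, (b) the exponent family `expSetting p e`, (c) the log-shell dilates `shellSetting p d` /
`rhoOne`, (d) the frame flip, and report the hold-sets») and abc-iut-rp-cx's CX-RECIPE v1 §1–§4 (models of record, normal forms).

RESULTS (every prime `p`; all closed, axioms standard):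
* §1 LS one-operator family `(shellSetting p d, rhoOne p d, qDatum p)` (abc-iut-w4-d048, p420995 / OneRho):
  `joshiDominance_oneRho_iff : H_J1 ↔ 3 ≤ d` and `joshiVolumeDominance_shell_iff : H_J2 ↔ 3 ≤ d` — the hold-set of BOTH candidates
  on LS is `{d ≥ 3}` = the `GapH3`/`Licence` set (`oneRho_gapH3_iff`, `shell_licence_iff`), strictly inside the Statement set
  `{d | 3 ≤ 2d}` (`shell_statement_iff`): confirms rp-j1's prediction (STATUS 06:04:56Z) «H_J1 ⟺ H_J2 ⟺ d ≥ 3».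
* §2 EXP family `(expSetting p e, ballOfMonoid p, qDatumExp p e)` (abc-iut-w5-d161, p420276):
  `joshiDominance_exp_iff : H_J1 ↔ (1 ≤ e₁ ∧ 4 ≤ e₂)` and `joshiVolumeDominance_exp_iff : H_J2 ↔ (1 ≤ e₁ ∧ 4 ≤ e₂)` — i.e.
  `e_j ≥ j²` at both labels; this hold-set sits STRICTLY BETWEEN the residual's `{e = (1,4)}` (`expSetting_reading3_iff'`) and the
  Statement's `{5 ≤ e₁ + e₂}` (`expSetting_statement_iff`): witnesses `exp_one_five` (H holds, residual fails) and `exp_two_three`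
  (Statement holds, H fails).
* §3 FLIP `(flipSetting p, orbitRegion p, qDatum p)` (abc-iut-w4-d048): BOTH candidates FAIL there (`not_joshiDominance_flip`,
  `not_joshiVolumeDominance_flip`) although the Statement, the Licence and `GapH3` HOLD at the flip (`flip_statement`) — H_J1/H_J2 are
  sufficient, not necessary, for the typed Corollary (concordant with `pinned_exponent_census`).
* §4 T-c: `joshiDominance_linkId` (SAT0 at P♭, where the residual holds too) and the SAT⁺ package `joshi_candidates_satPlus` at
  `(naiveFull 2, shellSetting 2 3, rhoOne 2 3, qDatum 2)`: typed Thm. 3.11 ∧ BridgeHyps ∧ AbsLogQPos ∧ PinnedRegions3 ∧ H_J1 ∧ H_J2 ∧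
  Statement ∧ ¬GapA3 ∧ ¬PilotKummerIndRelated (the last by abc-iut-rp-m3's `CandMochizuki32.not_S_oneRho`) — an HONESTLY
  j²-SCALED, label-independent-q model family (d ≥ 3) where both
  candidates hold and the residual of record fails: grade SAT⁺ in the sense of REPAIR-SPEC §3 T-c.

HONEST FRAMING: toys of the typed interface over `toyIndex` (`l⋇ = 2`); nothing here asserts abc or [IUTchIII] Cor. 3.12 or takes a
side between Mochizuki / Scholze–Stix / Joshi; H_J1/H_J2 are HYPOTHESES typed by abc-iut-rp-j1 — typed ≠ proved, instantiated ≠ endorsed.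
[claim: Joshi2024ATSIII, status: disputed] -/

noncomputable section

open Set

namespace Summit.ABC.IUTFork.Repair.CandJoshi1Profile

open Thm311 Cor312 Cor312.Checks Cor312.IdentifiedNonVacuity Cor312Vol Literature.IUT.LogThetaLattice
open Cor312Vol.NaiveWitness Cor312Vol.PinnedWitness Cor312Vol.PinnedHonest
open Summit.ABC.IUTFork.Repair.CandJoshi1

variable (p : ℕ) [hp : Fact p.Prime] (d : ℕ)

/-! ## 0. Normal forms -/
/-- `j² ≤ 4` for every label of `toyIndex` (`l⋇ = 2`). [folklore] -/
theorem jsq_le_four (j : toyIndex.Label) : jsq j ≤ 4 := by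
  unfold jsq
  have hj : ((j : toyIndex.Label) : ℕ) ≤ 2 := Nat.le_of_lt_succ j.isLt
  have : ((j : toyIndex.Label) : ℕ) ^ 2 ≤ 2 ^ 2 := Nat.pow_le_pow_left hj 2
  exact_mod_cast this

/-- `jsq 2 = 4`, for the literal label and for `labelSucc ⟨1, _⟩`. [folklore] -/
theorem jsq_two : jsq (2 : toyIndex.Label) = 4 := by decide
/-- `jsq (labelSucc ⟨1,_⟩) = 4`. [folklore] -/
theorem jsq_labelSucc_one' : jsq (Setting.labelSucc (T := toyIndex) ⟨1, by decide⟩) = 4 := by decide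

/-- In the one-operator LS family the right-hand side of H_J1 is `Φ(rhoOne d (Ψ^{Frob}_m))_j = B_{j²−d}`. [folklore] -/
theorem rhoOne_frobΨ_translate {Φ : signShells.PacketAut}
    (hΦ : Φ ∈ Subgroup.closure (signShells.Ind1Family ∪ signShells.Ind2Family)) (n m : ℤ) (j : toyIndex.Label) (vQ : toyIndex.VQ) :
    Φ j vQ '' rhoOne p d (((naiveFull p).col n).frobΨ m) j vQ = pBall p j vQ (jsq j - d) := by
  rw [naiveFull_frobΨ, rhoOne_Psi, shellRegion_Psi, image_pBall_of_mem_closure p hΦ]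

/-- In the EXP / P♭ families (operator `ballOfMonoid`), the right-hand side of H_J1 is `B_{j²}`. [folklore] -/
theorem ballOfMonoid_frobΨ_translate {Φ : signShells.PacketAut}
    (hΦ : Φ ∈ Subgroup.closure (signShells.Ind1Family ∪ signShells.Ind2Family)) (n m : ℤ) (j : toyIndex.Label) (vQ : toyIndex.VQ) :
    Φ j vQ '' GluedMonoids.Naive.ballOfMonoid p (((naiveFull p).col n).frobΨ m) j vQ = pBall p j vQ (jsq j) := by
  rw [naiveFull_frobΨ, GluedMonoids.Naive.ballOfMonoid_psi, image_pBall_of_mem_closure p hΦ]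

/-! ## 1. The log-shell family LS(d): hold-sets of H_J1 and H_J2 -/

/-- **LS one-operator profile of H_J1: `JoshiDominance` holds at `(shellSetting p d, rhoOne p d, qDatum p)` IFF `3 ≤ d`.**
(→) at label `2` the q-side `B_1` must lie in `B_{4−d}`; (←) `B_1 ⊆ B_{j²−d}` for `j² ≤ 4 ≤ d + 1`, and `B_0 ⊆ B_{−d}` at the junk
label, with `Φ = 1`, `m = 0`. [claim: Joshi2024ATSIII, status: disputed] -/
theorem joshiDominance_oneRho_iff :
    JoshiDominance (naiveFull p).toLatticeSituation (shellSetting p d) (rhoOne p d) (qDatum p) ↔ 3 ≤ d := by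
  constructor
  · intro h
    obtain ⟨Φ, hΦ, m, hm⟩ := h 2 ()
    have hR : Φ 2 () '' rhoOne p d (((naiveFull p).toLatticeSituation.col (shellSetting p d).n).frobΨ m) 2 () = pBall p 2 () (jsq 2 - d) :=
      rhoOne_frobΨ_translate p d hΦ _ m 2 ()
    rw [hR, rhoOne_qDatum, orbitRegion_qDatum p (by decide), pBall_subset_iff, jsq_two] at hm
    omega
  · intro hd j vQ
    refine ⟨1, Subgroup.one_mem _, 0, ?_⟩
    have hR : (1 : signShells.PacketAut) j vQ '' rhoOne p d (((naiveFull p).toLatticeSituation.col (shellSetting p d).n).frobΨ 0) j vQ =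
        pBall p j vQ (jsq j - d) :=
      rhoOne_frobΨ_translate p d (Subgroup.one_mem _) _ 0 j vQ
    rw [hR, rhoOne_qDatum]
    by_cases hj : j = 0
    · subst hj
      rw [orbitRegion_zero, pBall_subset_iff]
      have := jsq_le_four (0 : toyIndex.Label)
      have h0 : jsq (0 : toyIndex.Label) = 0 := by decide
      omega
    · rw [orbitRegion_qDatum p hj, pBall_subset_iff]
      have := jsq_le_four j
      omega

/-- **LS profile of H_J2: `JoshiVolumeDominance` holds at `shellSetting p d` IFF `3 ≤ d`** (the only possible image at label `j` is
`B_{j²−d}` of log-volume `−(j²−d)·log p`; the q-term is `−log p`; `−1 ≤ −(j²−d)` at `j = 2` is `3 ≤ d`). [claim: Joshi2024ATSIII, status: disputed] -/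
theorem joshiVolumeDominance_shell_iff : JoshiVolumeDominance (shellSetting p d) ↔ 3 ≤ d := by
  have hl := log_p_pos p
  have hq : ∀ (i : Fin toyIndex.lstar) (vQ : toyIndex.VQ),
      (shellSetting p d).qLocal (Setting.labelSucc i) vQ = -(1 : ℝ) * Real.log p := fun i vQ => by
    show pVol p _ vQ ((shellSetting p d).qRegion (Setting.labelSucc i) vQ) = _
    rw [show (shellSetting p d).qRegion (Setting.labelSucc i) vQ = pBall p _ vQ 1 from
      pinnedSetting_qRegion_of_ne_zero p (Setting.labelSucc_ne_zero _) vQ, pVol_pBall]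
    push_cast; ring
  constructor
  · intro h
    obtain ⟨U, hU, hle⟩ := h ⟨1, by decide⟩ ()
    rw [shell_possibleImages, Set.mem_singleton_iff] at hU
    subst hU
    rw [hq] at hle
    change -(1 : ℝ) * Real.log p ≤ pVol p _ () (pBall p _ () (jsq (Setting.labelSucc (T := toyIndex) ⟨1, by decide⟩) - d)) at hle
    rw [pVol_pBall, jsq_labelSucc_one'] at hle
    have hk : (((4 : ℤ) - d : ℤ) : ℝ) ≤ 1 := by
      by_contra hc
      rw [not_le] at hc
      nlinarith
    have hk' : (4 : ℤ) - d ≤ 1 := by exact_mod_cast hk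
    omega
  · intro hd i vQ
    refine ⟨pBall p _ vQ (jsq (Setting.labelSucc i) - d), ?_, ?_⟩
    · rw [shell_possibleImages]; exact Set.mem_singleton _
    · rw [hq]
      change -(1 : ℝ) * Real.log p ≤ pVol p _ vQ (pBall p _ vQ (jsq (Setting.labelSucc i) - d))
      rw [pVol_pBall]
      have hj := jsq_le_four (Setting.labelSucc i)
      have hk : ((jsq (Setting.labelSucc i) - d : ℤ) : ℝ) ≤ 1 := by
        have : jsq (Setting.labelSucc i) - (d : ℤ) ≤ 1 := by omega
        exact_mod_cast this
      nlinarith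

/-- **LS regimes for the candidates**: at `d = 2` the typed Corollary HOLDS while BOTH Joshi-shaped candidates FAIL (so neither is
necessary); at `d = 3` both hold (with the Statement); at `d = 0, 1` everything fails. In particular the LS hold-set `{d ≥ 3}` excludes
`d = 1` AND `d = 2`, as REPAIR-SPEC §3 T-b requires of a level-H supplier. [folklore] -/
theorem ls_regimes :
    (¬ JoshiDominance (naiveFull p).toLatticeSituation (shellSetting p 2) (rhoOne p 2) (qDatum p) ∧
      ¬ JoshiVolumeDominance (shellSetting p 2) ∧ Summit.ABC.IUTFork.Cor312.Setting.Statement (shellSetting p 2)) ∧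
    (JoshiDominance (naiveFull p).toLatticeSituation (shellSetting p 3) (rhoOne p 3) (qDatum p) ∧
      JoshiVolumeDominance (shellSetting p 3) ∧ Summit.ABC.IUTFork.Cor312.Setting.Statement (shellSetting p 3)) := by
  refine ⟨⟨fun h => ?_, fun h => ?_, (shell_statement_iff p 2).2 (by norm_num)⟩,
    ⟨(joshiDominance_oneRho_iff p 3).2 le_rfl, (joshiVolumeDominance_shell_iff p 3).2 le_rfl,
      (shell_statement_iff p 3).2 (by norm_num)⟩⟩
  · have := (joshiDominance_oneRho_iff p 2).1 h; omega
  · have := (joshiVolumeDominance_shell_iff p 2).1 h; omega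

/-- Two-operator reading for the record, Θ-pin operator `shellRegion p d` for BOTH pilots: H_J1 NEVER holds (at label `2` it would put
`B_{1−d}` inside `B_{4−d}`). [folklore] -/
theorem not_joshiDominance_shellRegion :
    ¬ JoshiDominance (naiveFull p).toLatticeSituation (shellSetting p d) (shellRegion p d) (qDatum p) := by
  intro h
  obtain ⟨Φ, hΦ, m, hm⟩ := h 2 ()
  rw [naiveFull_frobΨ, shellRegion_Psi, image_pBall_of_mem_closure p hΦ, shellRegion_qDatum p d (by decide),
    pBall_subset_iff, jsq_two] at hm
  omega

/-! ## 2. The exponent family EXP(e): hold-sets of H_J1 and H_J2 -/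

section Exp

variable (e : toyIndex.LabelStar → ℕ)

/-- **EXP profile of H_J1: at `(expSetting p e, ballOfMonoid p, qDatumExp p e)`, `JoshiDominance` holds IFF `e_j ≥ j²` at both labels,
i.e. `1 ≤ e₁ ∧ 4 ≤ e₂`** (`B_{e_j} ⊆ B_{j²}`). [claim: Joshi2024ATSIII, status: disputed] -/
theorem joshiDominance_exp_iff :
    JoshiDominance (naiveFull p).toLatticeSituation (expSetting p e) (GluedMonoids.Naive.ballOfMonoid p) (fun v _ => qDatumExp p e v) ↔
      (1 ≤ e ⟨1, by decide⟩ ∧ 4 ≤ e ⟨2, by decide⟩) := by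
  constructor
  · intro h
    obtain ⟨Φ₁, hΦ₁, m₁, h₁⟩ := h 1 ()
    obtain ⟨Φ₂, hΦ₂, m₂, h₂⟩ := h 2 ()
    have hR₁ : Φ₁ 1 () '' GluedMonoids.Naive.ballOfMonoid p (((naiveFull p).toLatticeSituation.col (expSetting p e).n).frobΨ m₁) 1 () =
        pBall p 1 () (jsq 1) := ballOfMonoid_frobΨ_translate p hΦ₁ _ m₁ 1 ()
    have hR₂ : Φ₂ 2 () '' GluedMonoids.Naive.ballOfMonoid p (((naiveFull p).toLatticeSituation.col (expSetting p e).n).frobΨ m₂) 2 () =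
        pBall p 2 () (jsq 2) := ballOfMonoid_frobΨ_translate p hΦ₂ _ m₂ 2 ()
    rw [hR₁, ballOfMonoid_qDatumExp, pBall_subset_iff, expAt_of_ne_zero e (show (1 : toyIndex.Label) ≠ 0 by decide)] at h₁
    rw [hR₂, ballOfMonoid_qDatumExp, pBall_subset_iff, expAt_of_ne_zero e (show (2 : toyIndex.Label) ≠ 0 by decide)] at h₂
    have hj1 : jsq (1 : toyIndex.Label) = 1 := by decide
    rw [hj1] at h₁; rw [jsq_two] at h₂
    constructor
    · exact_mod_cast h₁
    · exact_mod_cast h₂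
  · rintro ⟨h1, h2⟩ j vQ
    refine ⟨1, Subgroup.one_mem _, 0, ?_⟩
    have hR : (1 : signShells.PacketAut) j vQ '' GluedMonoids.Naive.ballOfMonoid p
        (((naiveFull p).toLatticeSituation.col (expSetting p e).n).frobΨ 0) j vQ = pBall p j vQ (jsq j) :=
      ballOfMonoid_frobΨ_translate p (Subgroup.one_mem _) _ 0 j vQ
    rw [hR, ballOfMonoid_qDatumExp, pBall_subset_iff]
    by_cases hj : j = 0
    · subst hj
      unfold expAt; rw [dif_pos rfl]
      have : jsq (0 : toyIndex.Label) = 0 := by decide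
      omega
    · rw [expAt_of_ne_zero e hj]
      rcases labelStar_cases ⟨j, hj⟩ with hc | hc
      · have hj1 : j = 1 := congrArg Subtype.val hc
        subst hj1
        have : jsq (1 : toyIndex.Label) = 1 := by decide
        rw [this]
        have hc' : (⟨(1 : toyIndex.Label), hj⟩ : toyIndex.LabelStar) = ⟨1, by decide⟩ := hc
        rw [hc']
        exact_mod_cast h1
      · have hj2 : j = 2 := congrArg Subtype.val hc
        subst hj2
        rw [jsq_two]
        have hc' : (⟨(2 : toyIndex.Label), hj⟩ : toyIndex.LabelStar) = ⟨2, by decide⟩ := hc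
        rw [hc']
        exact_mod_cast h2

/-- **EXP profile of H_J2: `JoshiVolumeDominance (expSetting p e)` IFF `1 ≤ e₁ ∧ 4 ≤ e₂`** (q-term `−e_j·log p`, the one possible
image `B_{j²}` has log-volume `−j²·log p`). [claim: Joshi2024ATSIII, status: disputed] -/
theorem joshiVolumeDominance_exp_iff :
    JoshiVolumeDominance (expSetting p e) ↔ (1 ≤ e ⟨1, by decide⟩ ∧ 4 ≤ e ⟨2, by decide⟩) := by
  have hl := log_p_pos p
  have hPI : ∀ (j : toyIndex.Label) (vQ : toyIndex.VQ), (expSetting p e).possibleImages j vQ = {pBall p j vQ (jsq j)} :=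
    fun j vQ => withQDatum_possibleImages p _ (qDatumExp_hul p e) j vQ
  -- the value of H_J2 at label `i+1`, as an inequality of exponents
  have key : ∀ (i : Fin toyIndex.lstar) (vQ : toyIndex.VQ),
      (∃ U ∈ (expSetting p e).possibleImages (Setting.labelSucc i) vQ,
        (expSetting p e).qLocal (Setting.labelSucc i) vQ ≤ ((naiveSituation p).D (expSetting p e).n).logvol _ vQ U) ↔
      jsq (Setting.labelSucc i) ≤ (e ⟨Setting.labelSucc i, Setting.labelSucc_ne_zero i⟩ : ℤ) := fun i vQ => by
    rw [hPI]
    constructor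
    · rintro ⟨U, hU, hle⟩
      rw [Set.mem_singleton_iff] at hU
      subst hU
      rw [expSetting_qLocal_labelSucc] at hle
      change _ ≤ pVol p _ vQ (pBall p _ vQ (jsq (Setting.labelSucc i))) at hle
      rw [pVol_pBall] at hle
      have hk : ((jsq (Setting.labelSucc i) : ℤ) : ℝ) ≤ (e ⟨Setting.labelSucc i, Setting.labelSucc_ne_zero i⟩ : ℝ) := by
        by_contra hc
        rw [not_le] at hc
        nlinarith
      exact_mod_cast hk
    · intro hk
      refine ⟨pBall p _ vQ (jsq (Setting.labelSucc i)), Set.mem_singleton _, ?_⟩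
      rw [expSetting_qLocal_labelSucc]
      change _ ≤ pVol p _ vQ (pBall p _ vQ (jsq (Setting.labelSucc i)))
      rw [pVol_pBall]
      have hk' : ((jsq (Setting.labelSucc i) : ℤ) : ℝ) ≤ (e ⟨Setting.labelSucc i, Setting.labelSucc_ne_zero i⟩ : ℝ) := by
        exact_mod_cast hk
      nlinarith
  have hj1 : jsq (Setting.labelSucc (T := toyIndex) ⟨0, by decide⟩) = 1 := by decide
  have hL1 : (⟨Setting.labelSucc (T := toyIndex) ⟨0, by decide⟩, Setting.labelSucc_ne_zero _⟩ : toyIndex.LabelStar) = ⟨1, by decide⟩ := rfl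
  have hL2 : (⟨Setting.labelSucc (T := toyIndex) ⟨1, by decide⟩, Setting.labelSucc_ne_zero _⟩ : toyIndex.LabelStar) = ⟨2, by decide⟩ := rfl
  constructor
  · intro h
    have h₁ := (key ⟨0, by decide⟩ ()).1 (h ⟨0, by decide⟩ ())
    have h₂ := (key ⟨1, by decide⟩ ()).1 (h ⟨1, by decide⟩ ())
    rw [hj1, hL1] at h₁
    rw [jsq_labelSucc_one', hL2] at h₂
    constructor
    · exact_mod_cast h₁
    · exact_mod_cast h₂
  · rintro ⟨h1, h2⟩ i vQ
    refine (key i vQ).2 ?_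
    rcases (show i = ⟨0, by decide⟩ ∨ i = ⟨1, by decide⟩ by
        rcases i with ⟨i, hi⟩
        have : i = 0 ∨ i = 1 := by have := hi; unfold ThetaIndex.lstar toyIndex at this; simp at this; omega
        rcases this with rfl | rfl
        · exact Or.inl rfl
        · exact Or.inr rfl) with rfl | rfl
    · rw [hj1, hL1]; exact_mod_cast h1
    · rw [jsq_labelSucc_one', hL2]; exact_mod_cast h2

/-- **Position of the EXP hold-set**: residual `{e = (1,4)}` ⊊ H_J1 = H_J2 = `{e₁ ≥ 1 ∧ e₂ ≥ 4}` ⊊ Statement `{5 ≤ e₁ + e₂}`.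
Witness ABOVE the residual: `e = (1,5)` — both candidates HOLD and the Statement holds, while the residual of record `PilotKummerIndRelated`
FAILS (pins + Thm. 3.11 (ii) (b): residual ⟺ Reading R3 ⟺ `e = (1,4)`).
[folklore] -/
theorem exp_one_five :
    let e : toyIndex.LabelStar → ℕ := fun j => if j.1 = 1 then 1 else 5
    JoshiDominance (naiveFull p).toLatticeSituation (expSetting p e) (GluedMonoids.Naive.ballOfMonoid p) (fun v _ => qDatumExp p e v) ∧
      JoshiVolumeDominance (expSetting p e) ∧ (expSetting p e).Statement ∧
      ¬ PilotKummerIndRelated (naiveFull p).toLatticeSituation (expSetting p e) (GluedMonoids.Naive.ballOfMonoid p)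
          (fun v _ => qDatumExp p e v) := by
  intro e
  have h1 : e ⟨1, by decide⟩ = 1 := rfl
  have h2 : e ⟨2, by decide⟩ = 5 := rfl
  refine ⟨(joshiDominance_exp_iff p e).2 ⟨by rw [h1], by rw [h2]; norm_num⟩,
    (joshiVolumeDominance_exp_iff p e).2 ⟨by rw [h1], by rw [h2]; norm_num⟩,
    (expSetting_statement_iff p e).2 (by show 5 ≤ esum e; decide), fun hS => ?_⟩
  have hR := (reading3_iff_pilotKummerIndRelated _ _ _ _ (GluedMonoids.Naive.naive_kummerB p _)
    (expSetting_pinnedRegions p e)).2 hS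
  have := ((expSetting_reading3_iff' p e).1 hR).2
  rw [h2] at this
  exact absurd this (by norm_num)

/-- Witness BELOW the candidates but inside the Statement: `e = (2,3)` — the typed Corollary HOLDS (`5 ≤ 5`, attained) while BOTH
candidates FAIL (`4 ≤ 3` is false at label `2`): H_J1/H_J2 are not necessary for the Statement. [folklore] -/
theorem exp_two_three :
    (expSetting p expTwoThree).Statement ∧
      ¬ JoshiDominance (naiveFull p).toLatticeSituation (expSetting p expTwoThree) (GluedMonoids.Naive.ballOfMonoid p)
          (fun v _ => qDatumExp p expTwoThree v) ∧
      ¬ JoshiVolumeDominance (expSetting p expTwoThree) := by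
  have h2 : expTwoThree ⟨2, by decide⟩ = 3 := rfl
  refine ⟨(expSetting_statement_iff p _).2 (by rw [esum_expTwoThree]), fun h => ?_, fun h => ?_⟩
  · have := ((joshiDominance_exp_iff p _).1 h).2; rw [h2] at this; omega
  · have := ((joshiVolumeDominance_exp_iff p _).1 h).2; rw [h2] at this; omega

end Exp

/-! ## 3. The frame flip: both candidates FAIL where the Statement holds -/

/-- **FLIP: H_J1 FAILS at `(flipSetting p, orbitRegion p, qDatum p)`** — H_J1 reads only `P.n` and the regions `ρ(·)`, which are the
countermodel's (`B_1 ⊄ B_4` at label `2`); the coarse frame that makes the Statement true at the flip is invisible to it. [folklore] -/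
theorem not_joshiDominance_flip :
    ¬ JoshiDominance (naiveFull p).toLatticeSituation (flipSetting p) (orbitRegion p) (qDatum p) := by
  intro h
  obtain ⟨Φ, hΦ, m, hm⟩ := h 2 ()
  rw [naiveFull_frobΨ, orbitRegion_Psi, image_pBall_of_mem_closure p hΦ, orbitRegion_qDatum p (by decide),
    pBall_subset_iff, jsq_two] at hm
  omega

/-- **FLIP: H_J2 FAILS at `flipSetting p`** (the one possible image at label `2` is `B_4`, of log-volume `−4·log p < −log p` = the
q-term) — although `flip_statement`, `flip_licence`, `flip_gapH3` HOLD there. [folklore] -/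
theorem not_joshiVolumeDominance_flip : ¬ JoshiVolumeDominance (flipSetting p) := by
  intro h
  have hl := log_p_pos p
  obtain ⟨U, hU, hle⟩ := h ⟨1, by decide⟩ ()
  rw [flip_possibleImages, Set.mem_singleton_iff] at hU
  subst hU
  have hq : (flipSetting p).qLocal (Setting.labelSucc ⟨1, by decide⟩) () = -(1 : ℝ) * Real.log p := by
    show pVol p _ () ((pinnedSetting p).qRegion (Setting.labelSucc ⟨1, by decide⟩) ()) = _
    rw [pinnedSetting_qRegion_of_ne_zero p (Setting.labelSucc_ne_zero _) (), pVol_pBall]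
    push_cast; ring
  rw [hq] at hle
  change -(1 : ℝ) * Real.log p ≤ pVol p _ () (pBall p _ () (jsq (Setting.labelSucc (T := toyIndex) ⟨1, by decide⟩))) at hle
  rw [pVol_pBall, jsq_labelSucc_one'] at hle
  push_cast at hle
  nlinarith

/-- **FLIP, packaged**: pins ∧ BridgeHyps ∧ AbsLogQPos ∧ Statement ∧ Licence hold at the flip, BOTH candidates fail. [folklore] -/
theorem flip_separates :
    PinnedRegions3 (naiveFull p).toLatticeSituation (flipSetting p) (orbitRegion p) (qDatum p) ∧ BridgeHyps (flipSetting p) ∧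
      (flipSetting p).AbsLogQPos ∧ (flipSetting p).Statement ∧ Thm311ToCor312.Licence (flipSetting p) ∧
      ¬ JoshiDominance (naiveFull p).toLatticeSituation (flipSetting p) (orbitRegion p) (qDatum p) ∧
      ¬ JoshiVolumeDominance (flipSetting p) :=
  ⟨flip_pinnedRegions3 p, flip_bridgeHyps p, flip_absLogQPos p, flip_statement p, flip_licence p,
    not_joshiDominance_flip p, not_joshiVolumeDominance_flip p⟩

/-! ## 4. T-c: SAT0 at P♭ and the SAT⁺ family LS(d ≥ 3) -/

/-- (T-c, grade SAT0) H_J1 holds at abc-iut-w5-d247's link-identified setting P♭ (where the residual holds too). [claim: Joshi2024ATSIII, status: disputed] -/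
theorem joshiDominance_linkId :
    JoshiDominance (naiveFull p).toLatticeSituation (linkIdSetting p) (GluedMonoids.Naive.ballOfMonoid p) fun v _ => Psi p v :=
  joshiDominance_of_pilotKummerCompatRegion _ _ _ _ (linkId_pilotKummerCompatRegion p)

/-- (T-c, grade SAT0) H_J2 holds at P♭. [claim: Joshi2024ATSIII, status: disputed] -/
theorem joshiVolumeDominance_linkId : JoshiVolumeDominance (linkIdSetting p) :=
  joshiVolumeDominance_of_joshiDominance _ _ _ _ (linkId_bridgeHyps p) (linkId_pinnedRegions3 p).1 (joshiDominance_linkId p)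

/-- **(T-c, grade SAT⁺) at every prime and every `d ≥ 3`**: typed Thm. 3.11 ∧ BridgeHyps ∧ `|log(q)| > 0` ∧ PinnedRegions3 (one
honest, (Ind3)-aware, equivariant operator) ∧ H_J1 ∧ H_J2 ∧ the typed Statement, while the residual of record and `GapA3` FAIL — an
honestly j²-scaled, label-independent-q model where both Joshi-shaped candidates hold WITHOUT the identification-level residual.
[claim: Joshi2024ATSIII, status: disputed] -/
theorem joshi_candidates_hold_on_ls (hd : 3 ≤ d) :
    (naiveFull p).Statement ∧ BridgeHyps (shellSetting p d) ∧ (shellSetting p d).AbsLogQPos ∧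
      PinnedRegions3 (naiveFull p).toLatticeSituation (shellSetting p d) (rhoOne p d) (qDatum p) ∧
      JoshiDominance (naiveFull p).toLatticeSituation (shellSetting p d) (rhoOne p d) (qDatum p) ∧
      JoshiVolumeDominance (shellSetting p d) ∧ Summit.ABC.IUTFork.Cor312.Setting.Statement (shellSetting p d) ∧
      ¬ GapA3 (naiveFull p).toLatticeSituation (shellSetting p d) (rhoOne p d) (qDatum p) ∧
      ¬ PilotKummerIndRelated (naiveFull p).toLatticeSituation (shellSetting p d) (rhoOne p d) (qDatum p) :=
  ⟨naiveFull_statement p, shell_bridgeHyps p d, shell_absLogQPos p d, oneRho_pinnedRegions3 p d,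
    (joshiDominance_oneRho_iff p d).2 hd, (joshiVolumeDominance_shell_iff p d).2 hd,
    (shell_statement_iff p d).2 (by omega), oneRho_not_gapA3 p d, CandMochizuki32.not_S_oneRho p d⟩

omit hp d in
/-- **(T-c) packaged ∃, grade SAT⁺, at `p = 2`, `d = 3`** in the shape REPAIR-SPEC §2 item 4 asks for (`F.Statement ∧ BridgeHyps ∧
AbsLogQPos ∧ PinnedRegions3 ∧ H`), for both candidates at once, together with the typed Statement and the failure of the residual.
[claim: Joshi2024ATSIII, status: disputed] -/
theorem joshi_candidates_satPlus :
    ∃ (T : ThetaIndex) (F : FullSituation T) (P : Cor312.Setting F.toLatticeSituation.toSituation)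
      (ρ : (∀ v : T.V, v ∈ T.Vbad → Set (F.L.StarPacket v)) → ∀ (j : T.Label) (vQ : T.VQ), Set (F.L.Packet j vQ))
      (qK : ∀ v : T.V, v ∈ T.Vbad → Set (F.L.StarPacket v)),
      F.Statement ∧ BridgeHyps P ∧ P.AbsLogQPos ∧ PinnedRegions3 F.toLatticeSituation P ρ qK ∧
      JoshiDominance F.toLatticeSituation P ρ qK ∧ JoshiVolumeDominance P ∧ P.Statement ∧
      ¬ PilotKummerIndRelated F.toLatticeSituation P ρ qK := by
  haveI : Fact (Nat.Prime 2) := ⟨Nat.prime_two⟩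
  obtain ⟨h1, h2, h3, h4, h5, h6, h7, -, h9⟩ := joshi_candidates_hold_on_ls 2 3 le_rfl
  exact ⟨toyIndex, naiveFull 2, shellSetting 2 3, rhoOne 2 3, qDatum 2, h1, h2, h3, h4, h5, h6, h7, h9⟩

end Summit.ABC.IUTFork.Repair.CandJoshi1Profile

end
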